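import Literature.NumberTheory.Rogawski1990.CohomologicalFinComponentIsTheta
import Literature.NumberTheory.Automorphic.UnitaryGroupPlaceInclusion
import Literature.NumberTheory.Automorphic.Liu2021.Def411WeilCarriersLocalIsotypyAtPlace
import Literature.NumberTheory.Automorphic.Liu2021.Def411WeilCarriersLocalTypesOfEquiv
import Literature.NumberTheory.Automorphic.UnitaryGroupLocalCongr
import Literature.RepresentationTheory.Liu2021.GlobalOscillatorIsomorphismCriterion
import Literature.NumberTheory.GelbartRogawski1991.FiniteAdelicWeilCentralCoinvariantsIsotypic
import Literature.NumberTheory.GelbartRogawski1991.LocalSplittingCMLocality                 -- ★ B-p13: `undoubledSplittings_cmFinLocalFamily_s_congr`, `congrW_s_congr`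
import Literature.NumberTheory.Automorphic.TorusCharacterLocalComponents                   -- ★ `HeckeCharacter.semilocalComponent`
import Literature.NumberTheory.Automorphic.IrreducibleClassesComap
import Literature.NumberTheory.Rogawski1990.GlobalAPacketLetters
import Summits.HodgeConjecture.CorCM.B01.Transposition.Item6OmegaChiSplitting           -- ★ B01 `OmegaChiSplitting.chiLocalSplittingsD`
import Summits.HodgeConjecture.HodgeConjecture.Theorems.F0P2cOmegaLocalType              -- ★ p803803: `formCongr_frame`
import HarnessLib

/-!
# FLOOR-0 P2 — PKΠ RUNG 4, row «GRD-LOC»: the theta vocabulary `X_v(μ,ε,χf) ∘ κ_v⁻¹` ∕ `IsoAtXf` ∕ `ThetaTypeAt` is LOCAL in `μ`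

Cell hodgecm-mathlib (D-0151), FLOOR 0, programme P2 (theta ∕ `hdictE`); crux item H413 = stmt-HodgeConjecture-24833 (`HCCMUnconditional.H413`).
Sub-line of record `Cruxes/H413/Lines/F0_P2PKPiRung4.lean` v1.1 (F0P2-plan (g6); sha16 2e54cdb2dda5824f): PKΠ ⟸ S2♭ + GRD + RIG∞ + RIGf, whose LOCAL
letter `StubGRD` (:318) outputs a dictionary pair `(μ₀, χf)` together with the LOCALITY CLAUSE «every conjugate-symplectic `μ` with the same semi-local
components `(toHeckeCharacter L μ).semilocalComponent L v` as `μ₀` at all finite `v` satisfies `GRDMatrix … μ hμ χf`» (RIG∞ then swaps `μ₀` for a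
weight-one `μ1` with the same finite components).  Seat F0P2-p02 (g4), row «GRD-LOC» (P2 bus bid 08:34:52Z, GO F0P2-plan (g6) 08:45:14Z (1)).
THEOREMS ONLY (no `def`, no instance, no notation, no named fact, no `sorry`); never imports a `Cruxes/…/Lines` module (O50-1 ∕ s347 ∕ s380b: the
§4 statements RESTATE the bodies of the sub-line's `IsoAtXf` (:214) and `ThetaTypeAt` (:247) token for token); `--supports stmt-HodgeConjecture-24833
--as helper`.  HC_CM is proved only modulo the printed citations until rung 0 closes; this file discharges none of them — it discharges the locality
clause of `StubGRD` ONCE, so that the (S)∕(N) closers and the `stubGRD_holds` assembly (DICT-CHOICE PROTOCOL 08:32:01Z: named pair `grdMu`∕`grdChi` of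
`Theorems/F0P2iGRDWitness.lean`) need the matrix AT THE DICTIONARY PAIR only.

WHY IT IS TRUE (kernel bookkeeping over ★ tree facts, no new mathematics).  The representation `X_v(μ,ε,χf) ∘ κ_v⁻¹` of `U(H)(L⁺_v)` (the term inside
`IsoAt`∕`IsoAtXf`∕`ThetaTypeAt`: `TwistedCoinv.rep (localCharOfCenter … χf v) ((chiLocalSplittingsD ⟨L⟩ e₁ dV hdV hdV0 (toHeckeCharacter L μ) _ ε).omegaLoc v)
(commute_omegaLoc_localCenter …) ∘ localLineInl ∘ (localCongr … g … v)⁻¹`) reads `μ` ONLY through the `χ`-attached local splittings package ★ B01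
`OmegaChiSplitting.chiLocalSplittingsD … (toHeckeCharacter L μ) … ε = congrW … (undoubledSplittings … (cmFinLocalFamily …))`, and that package's SECTION
AT `v` is built from the local components `(μ_w)_{w ∣ v}` [Kudla1994 Thm. 3.1: the splitting is determined by `χ_v`; Liu2021 App. D §D.1 Step 2 «`ι_μ` depends
on `μ`», read at `μ_v`] — in the tree: ★ B-p13 `GRConstruction.undoubledSplittings_cmFinLocalFamily_s_congr` + ★ `congrW_s_congr` (`LocalSplittingCMLocality`).
The semi-local component `χ ∘ semilocalUnits v = ∏_{w ∣ v} χ_w` (★ `semilocalComponent_eq_prod`) IS Liu's Step-2 character ★ `localMu` (§1), and ★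
`forall_localComponent_eq_of_localMu_eq` recovers every `χ_w`, `w ∣ v`, from it.  So equal semi-local components give THE SAME section at `v` (§2), the same
local Weil representation `ω_v = toRep ∘ s_v` (§2), and therefore the two `X_v`-terms differ only in the PROOF argument `commute_omegaLoc_localCenter …` of
`TwistedCoinv.rep` — proof irrelevance makes every isotypic component against them coincide (§3, for every `ℂ[U(H)(L⁺_v)]`-module; no intertwiner is
built), whence `IsoAtXf` and `ThetaTypeAt` transfer from `μ'` to `μ` (§4).  The matrix∕letter forms (`GRDMatrix`, `StubGRD`) are in the sequel
`Theorems/F0P2iGRDMatrixLocality.lean`.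

* §1 `localMu_eq_semilocalComponent`, `forall_localComponent_eq_of_semilocalComponent_eq`;
* §2 `chiLocalSplittingsD_s_congr`, `omegaLoc_chiLocalSplittingsD_congr`;
* §3 `isotypicComponent_theta_congr` (every module `M`);
* §4 `isoAtXf_congr_of_semilocal_eq`, `thetaTypeAt_congr_of_semilocal_eq` (bodies of `IsoAtXf` ∕ `ThetaTypeAt` VERBATIM at `(μ', hμ')` ⟹ at `(μ, hμ)`).

## References
* [Liu2021] Y. Liu, Camb. J. Math. 9 (2021) = arXiv:2102.11518: Def. 4.11 (l. 2086–2096), App. D §D.1 Step 2–3 (l. 5219–5221).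
* [Kudla1994] S. Kudla, *Splitting metaplectic covers of dual reductive pairs*, Israel J. Math. 87 (1994): §3 Thm. 3.1.
* [GelbartRogawski1991] S. Gelbart, J. Rogawski, Invent. Math. 105 (1991): §3.1 Prop. 3.1.1 p. 455; §5.1 (5.1.1), Lem. 5.1.2 p. 466.
* [TateThesis1967] J. Tate, in Cassels–Fröhlich (1967): §3.2, §4.3 (local components of idele class characters).
-/

set_option autoImplicit false
set_option linter.dupNamespace false

noncomputable section

open NumberField MeasureTheory IsDedekindDomain
open scoped Matrix ComplexOrder

namespace Summit.HodgeConjecture.HodgeConjecture.Cruxes.H413.F0P2iGRDLocality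

open Literature.NumberTheory Literature.NumberTheory.Automorphic Literature.NumberTheory.Automorphic.UnitaryGroup
open Literature.NumberTheory.Automorphic.UnitaryGroup.CotangentForms
open Literature.NumberTheory.Automorphic.IdeleClassGroup
open Literature.NumberTheory.Automorphic.Liu2021 Literature.NumberTheory.Automorphic.Liu2021.Def411WeilCarriers
open Literature.NumberTheory.Automorphic.Liu2021.Def411WeilCarriersDoubling
open Literature.NumberTheory.GelbartRogawski1991 Literature.NumberTheory.GelbartRogawski1991.UnitaryDualPair
open Literature.NumberTheory.GelbartRogawski1991.UnitaryDualPair.WeilCoinv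
open Literature.NumberTheory.GelbartRogawski1991.UnitaryDualPair.LocalSplitting
open Literature.NumberTheory.GelbartRogawski1991.GRConstruction (congrW_s_congr undoubledSplittings_cmFinLocalFamily_s_congr)
open Literature.RepresentationTheory Literature.RepresentationTheory.Liu2021
open Literature.NumberTheory.GaloisRepresentations
open Literature.NumberTheory.Rogawski1990
open Summit.HodgeConjecture.CorCM.Transposition

/-! ## §1 `localMu` IS the semi-local component -/

/-- Liu's Step-2 character `μ_v = ∏_{w ∣ v} χ_w` (★ `localMu`) IS the semi-local component `χ ∘ semilocalUnits v`
(★ `HeckeCharacter.semilocalComponent`): both are `u ↦ ∏_{w ∣ v} χ_w (u_w)`. [cite: TateThesis1967, §4.3] [cite: Liu2021, App. D §D.1 Step 2 (l. 5219)] -/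
theorem localMu_eq_semilocalComponent (L : Type) [Field L] [NumberField L] [IsCMField L] (χ : HeckeCharacter L)
    (v : HeightOneSpectrum (𝓞 ↥(maximalRealSubfield L))) :
    localMu L χ v = χ.semilocalComponent L v := by
  refine MonoidHom.ext fun u => ?_
  rw [semilocalComponent_eq_prod, localMu, MonoidHom.finsetProd_apply]
  exact Finset.prod_congr rfl fun w _ => by
    rw [MonoidHom.coe_comp, Function.comp_apply]
    exact congrArg _ (Units.ext rfl)

/-- **equal semi-local components at `v` ⟹ equal local components at every `w ∣ v`.** [cite: TateThesis1967, §4.3] -/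
theorem forall_localComponent_eq_of_semilocalComponent_eq (L : Type) [Field L] [NumberField L] [IsCMField L]
    (χ χ' : HeckeCharacter L) (v : HeightOneSpectrum (𝓞 ↥(maximalRealSubfield L)))
    (h : χ.semilocalComponent L v = χ'.semilocalComponent L v) (w : PlacesOver L v) :
    χ.localComponent w.1 = χ'.localComponent w.1 :=
  forall_localComponent_eq_of_localMu_eq L v χ χ' (by rw [localMu_eq_semilocalComponent, localMu_eq_semilocalComponent, h]) w

/-! ## §2 The `χ`-attached local section and local Weil representation at `v` are local in `μ` -/

/-- **the section at `v` of the `χ`-attached local splittings `chiLocalSplittingsD … μ … ε` depends on `μ` only through its semi-local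
component at `v`** (★ B-p13 `undoubledSplittings_cmFinLocalFamily_s_congr` + ★ `congrW_s_congr`, read at `chiLocalSplittingsD = congrW … (undoubledSplittings …)`).
[cite: Kudla1994, §3 Thm. 3.1] [cite: Liu2021, App. D §D.1 Step 2 (l. 5219)] -/
theorem chiLocalSplittingsD_s_congr (L : Type) [Field L] [NumberField L] [IsCMField L] {n' : ℕ} (e₁ : Fin 3 × Fin 1 ≃ Fin n')
    (dV : Fin 3 → L) (hdV : ∀ i, IsCMField.complexConj L (dV i) = dV i) (hdV0 : ∀ i, dV i ≠ 0)
    (χ χ' : HeckeCharacter L) (hχ : Literature.RepresentationTheory.HarrisKudlaSweet1996.IsSplittingChar L 1 χ)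
    (hχ' : Literature.RepresentationTheory.HarrisKudlaSweet1996.IsSplittingChar L 1 χ') (ε : (↥(maximalRealSubfield L))ˣ)
    (v : HeightOneSpectrum (𝓞 ↥(maximalRealSubfield L))) (h : χ.semilocalComponent L v = χ'.semilocalComponent L v) :
    (OmegaChiSplitting.chiLocalSplittingsD ⟨L⟩ e₁ dV hdV hdV0 χ hχ ε).s v =
      (OmegaChiSplitting.chiLocalSplittingsD ⟨L⟩ e₁ dV hdV hdV0 χ' hχ' ε).s v :=
  congrW_s_congr L e₁ dV hdV _ _ _ _ _ _ _ _ _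
    (undoubledSplittings_cmFinLocalFamily_s_congr L e₁ dV hdV hdV0 _ _ _ _ v χ χ' hχ hχ'
      (forall_localComponent_eq_of_semilocalComponent_eq L χ χ' v h))

-- the `FinLocalSplittings` telescope of `chiLocalSplittingsD` (Gram data `gram … (TW ε)`, `reindex e₁ e₁ (diag dV ⊗ₖ JW ε)`) is expensive to unify
set_option maxHeartbeats 1600000 in
/-- **the local Weil representation `ω_v` of the `χ`-attached splittings is local in `μ`.** [cite: Kudla1994, §3 Thm. 3.1] [cite: Liu2021, App. D §D.1 Step 2 (l. 5219)] -/
theorem omegaLoc_chiLocalSplittingsD_congr (L : Type) [Field L] [NumberField L] [IsCMField L] {n' : ℕ} (e₁ : Fin 3 × Fin 1 ≃ Fin n')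
    (dV : Fin 3 → L) (hdV : ∀ i, IsCMField.complexConj L (dV i) = dV i) (hdV0 : ∀ i, dV i ≠ 0)
    (χ χ' : HeckeCharacter L) (hχ : Literature.RepresentationTheory.HarrisKudlaSweet1996.IsSplittingChar L 1 χ)
    (hχ' : Literature.RepresentationTheory.HarrisKudlaSweet1996.IsSplittingChar L 1 χ') (ε : (↥(maximalRealSubfield L))ˣ)
    (v : HeightOneSpectrum (𝓞 ↥(maximalRealSubfield L))) (h : χ.semilocalComponent L v = χ'.semilocalComponent L v) :
    (OmegaChiSplitting.chiLocalSplittingsD ⟨L⟩ e₁ dV hdV hdV0 χ hχ ε).omegaLoc v =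
      (OmegaChiSplitting.chiLocalSplittingsD ⟨L⟩ e₁ dV hdV hdV0 χ' hχ' ε).omegaLoc v := by
  have hs := chiLocalSplittingsD_s_congr L e₁ dV hdV hdV0 χ χ' hχ hχ' ε v h
  unfold FinLocalSplittings.omegaLoc
  rw [hs]

/-! ## §3 The theta representation `X_v(μ, ε, χf) ∘ κ_v⁻¹` of `U(H)(L⁺_v)`: its isotypic components are local in `μ` -/

set_option synthInstance.maxHeartbeats 400000 in
set_option maxHeartbeats 8000000 in
/-- **`X_v(μ, ε, χf) ∘ κ_v⁻¹` is local in `μ` on isotypic components**: if `μ, μ'` (conjugate-symplectic) have the same semi-local component at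
`v`, then for EVERY module `M` over `ℂ[U(H)(L⁺_v)]` the `X_v(μ,ε,χf)∘κ_v⁻¹`- and `X_v(μ',ε,χf)∘κ_v⁻¹`-isotypic components of `M` coincide — the two
representation terms (VERBATIM the `IsoAt`∕`IsoAtXf`∕`ThetaTypeAt` term of `Lines/F0_P2PKPiRung4.lean` §1) differ only in a PROOF argument once the
local Weil representations are identified (§2), so no intertwiner is needed. [cite: Liu2021, Def. 4.11 (l. 2090–2096), App. D §D.1 Step 2–3] [cite: Kudla1994, §3 Thm. 3.1] -/
theorem isotypicComponent_theta_congr (L : Type) [Field L] [NumberField L] [IsCMField L] (H : Matrix (Fin 3) (Fin 3) L) {n' : ℕ}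
    (e₁ : Fin 3 × Fin 1 ≃ Fin n') (dV : Fin 3 → L) (hdV : ∀ i, IsCMField.complexConj L (dV i) = dV i) (hdV0 : ∀ i, dV i ≠ 0)
    (g : GL (Fin 3) L) (hg : ((g : Matrix (Fin 3) (Fin 3) L).map (cmConjRingHom L))ᵀ * H * (g : Matrix (Fin 3) (Fin 3) L) = Matrix.diagonal dV)
    (μ μ' : Literature.NumberTheory.Automorphic.IdeleClassGroup L →ₜ* Circle) (hμ : IsConjugateSymplectic L μ)
    (hμ' : IsConjugateSymplectic L μ')
    (χf : UnitaryGroup.finAdelicOne (↥(maximalRealSubfield L)) L (IsCMField.complexConj L) →* ℂˣ) (ε : (↥(maximalRealSubfield L))ˣ)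
    (v : HeightOneSpectrum (𝓞 ↥(maximalRealSubfield L)))
    (h : (toHeckeCharacter L μ).semilocalComponent L v = (toHeckeCharacter L μ').semilocalComponent L v)
    (M : Type*) [AddCommGroup M] [Module (MonoidAlgebra ℂ (localPi L (IsCMField.complexConj L) 3 H v)) M] :
    isotypicComponent (MonoidAlgebra ℂ (localPi L (IsCMField.complexConj L) 3 H v)) M
      (Representation.asModule
        (((show Representation ℂ (localPi L (IsCMField.complexConj L) 3 (Matrix.diagonal dV) v) _ from
          (TwistedCoinv.rep (localCharOfCenter (↥(maximalRealSubfield L)) L (IsCMField.complexConj L)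
              (JW (↥(maximalRealSubfield L)) L ε) (JW_apply_ne_zero (↥(maximalRealSubfield L)) L ε) χf v)
            ((OmegaChiSplitting.chiLocalSplittingsD ⟨L⟩ e₁ dV hdV hdV0 (toHeckeCharacter L μ)
              ((isOscillatorChar_toHeckeCharacter_iff μ).mpr hμ) ε).omegaLoc v)
            (commute_omegaLoc_localCenter (↥(maximalRealSubfield L)) L (IsCMField.complexConj L) 3 e₁ (Matrix.diagonal dV)
              (JW (↥(maximalRealSubfield L)) L ε) (complexConj_imagUnit L) (imagUnit_ne_zero L) (imagUnit_mul_self L)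
              (realDiagonal_isSymm L dV hdV) (isSymm_TW (↥(maximalRealSubfield L)) ε) (realDiagonal_map L dV hdV).symm
              (JW_eq (↥(maximalRealSubfield L)) L ε) (JW_apply_ne_zero (↥(maximalRealSubfield L)) L ε)
              (OmegaChiSplitting.chiLocalSplittingsD ⟨L⟩ e₁ dV hdV hdV0 (toHeckeCharacter L μ)
                ((isOscillatorChar_toHeckeCharacter_iff μ).mpr hμ) ε) v)).comp
            (UnitaryGroup.localLineInl L (IsCMField.complexConj L) 3 e₁ (Matrix.diagonal dV) (JW (↥(maximalRealSubfield L)) L ε) v)) :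
            localPi L (IsCMField.complexConj L) 3 (Matrix.diagonal dV) v →* _).comp
          (localCongr L (IsCMField.complexConj L) g one_ne_zero
            (F0P2cOmegaLocalType.formCongr_frame L H dV g hg) v).symm.toMulEquiv.toMonoidHom)) =
    isotypicComponent (MonoidAlgebra ℂ (localPi L (IsCMField.complexConj L) 3 H v)) M
      (Representation.asModule
        (((show Representation ℂ (localPi L (IsCMField.complexConj L) 3 (Matrix.diagonal dV) v) _ from
          (TwistedCoinv.rep (localCharOfCenter (↥(maximalRealSubfield L)) L (IsCMField.complexConj L)
              (JW (↥(maximalRealSubfield L)) L ε) (JW_apply_ne_zero (↥(maximalRealSubfield L)) L ε) χf v)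
            ((OmegaChiSplitting.chiLocalSplittingsD ⟨L⟩ e₁ dV hdV hdV0 (toHeckeCharacter L μ')
              ((isOscillatorChar_toHeckeCharacter_iff μ').mpr hμ') ε).omegaLoc v)
            (commute_omegaLoc_localCenter (↥(maximalRealSubfield L)) L (IsCMField.complexConj L) 3 e₁ (Matrix.diagonal dV)
              (JW (↥(maximalRealSubfield L)) L ε) (complexConj_imagUnit L) (imagUnit_ne_zero L) (imagUnit_mul_self L)
              (realDiagonal_isSymm L dV hdV) (isSymm_TW (↥(maximalRealSubfield L)) ε) (realDiagonal_map L dV hdV).symm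
              (JW_eq (↥(maximalRealSubfield L)) L ε) (JW_apply_ne_zero (↥(maximalRealSubfield L)) L ε)
              (OmegaChiSplitting.chiLocalSplittingsD ⟨L⟩ e₁ dV hdV hdV0 (toHeckeCharacter L μ')
                ((isOscillatorChar_toHeckeCharacter_iff μ').mpr hμ') ε) v)).comp
            (UnitaryGroup.localLineInl L (IsCMField.complexConj L) 3 e₁ (Matrix.diagonal dV) (JW (↥(maximalRealSubfield L)) L ε) v)) :
            localPi L (IsCMField.complexConj L) 3 (Matrix.diagonal dV) v →* _).comp
          (localCongr L (IsCMField.complexConj L) g one_ne_zero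
            (F0P2cOmegaLocalType.formCongr_frame L H dV g hg) v).symm.toMulEquiv.toMonoidHom)) := by
  have hω := omegaLoc_chiLocalSplittingsD_congr L e₁ dV hdV hdV0 (toHeckeCharacter L μ) (toHeckeCharacter L μ')
    ((isOscillatorChar_toHeckeCharacter_iff μ).mpr hμ) ((isOscillatorChar_toHeckeCharacter_iff μ').mpr hμ') ε v h
  generalize commute_omegaLoc_localCenter (↥(maximalRealSubfield L)) L (IsCMField.complexConj L) 3 e₁ (Matrix.diagonal dV)
      (JW (↥(maximalRealSubfield L)) L ε) (complexConj_imagUnit L) (imagUnit_ne_zero L) (imagUnit_mul_self L)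
      (realDiagonal_isSymm L dV hdV) (isSymm_TW (↥(maximalRealSubfield L)) ε) (realDiagonal_map L dV hdV).symm
      (JW_eq (↥(maximalRealSubfield L)) L ε) (JW_apply_ne_zero (↥(maximalRealSubfield L)) L ε)
      (OmegaChiSplitting.chiLocalSplittingsD ⟨L⟩ e₁ dV hdV hdV0 (toHeckeCharacter L μ)
        ((isOscillatorChar_toHeckeCharacter_iff μ).mpr hμ) ε) v = hc
  generalize commute_omegaLoc_localCenter (↥(maximalRealSubfield L)) L (IsCMField.complexConj L) 3 e₁ (Matrix.diagonal dV)
      (JW (↥(maximalRealSubfield L)) L ε) (complexConj_imagUnit L) (imagUnit_ne_zero L) (imagUnit_mul_self L)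
      (realDiagonal_isSymm L dV hdV) (isSymm_TW (↥(maximalRealSubfield L)) ε) (realDiagonal_map L dV hdV).symm
      (JW_eq (↥(maximalRealSubfield L)) L ε) (JW_apply_ne_zero (↥(maximalRealSubfield L)) L ε)
      (OmegaChiSplitting.chiLocalSplittingsD ⟨L⟩ e₁ dV hdV hdV0 (toHeckeCharacter L μ')
        ((isOscillatorChar_toHeckeCharacter_iff μ').mpr hμ') ε) v = hc'
  revert hc hc'
  rw [hω]
  intro hc hc'
  rfl

/-! ## §4 The rung-4 predicates `IsoAtXf` and `ThetaTypeAt` (bodies VERBATIM, `Lines/F0_P2PKPiRung4.lean` v1.1 :214 ∕ :247) are local in `μ` -/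

set_option synthInstance.maxHeartbeats 400000 in
set_option maxHeartbeats 8000000 in
/-- **`IsoAtXf` is local in `μ`**: if `μ` and `μ'` have the same semi-local component at `v`, then «`σ ∘ inclPlace v` is `X_v(μ',ε,χf)∘κ_v⁻¹`-isotypic»
implies «`σ ∘ inclPlace v` is `X_v(μ,ε,χf)∘κ_v⁻¹`-isotypic».  Hypothesis and conclusion = the body of `F0P2PKPiRung4.IsoAtXf` VERBATIM (v1.1 :214) at
`(μ', hμ')` resp. `(μ, hμ)`; proof = §3. [cite: Liu2021, Def. 4.11 (l. 2090–2096), App. D §D.1 Step 2] [cite: Kudla1994, §3 Thm. 3.1] -/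
theorem isoAtXf_congr_of_semilocal_eq (L : Type) [Field L] [NumberField L] [IsCMField L] (H : Matrix (Fin 3) (Fin 3) L) {n' : ℕ}
    (e₁ : Fin 3 × Fin 1 ≃ Fin n') (dV : Fin 3 → L) (hdV : ∀ i, IsCMField.complexConj L (dV i) = dV i) (hdV0 : ∀ i, dV i ≠ 0)
    (g : GL (Fin 3) L) (hg : ((g : Matrix (Fin 3) (Fin 3) L).map (cmConjRingHom L))ᵀ * H * (g : Matrix (Fin 3) (Fin 3) L) = Matrix.diagonal dV)
    {W : Type} [AddCommGroup W] [Module ℂ W] (σ : Representation ℂ (finAdelic (↥(maximalRealSubfield L)) L (IsCMField.complexConj L) 3 H) W)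
    (μ μ' : Literature.NumberTheory.Automorphic.IdeleClassGroup L →ₜ* Circle) (hμ : IsConjugateSymplectic L μ)
    (hμ' : IsConjugateSymplectic L μ')
    (χf : UnitaryGroup.finAdelicOne (↥(maximalRealSubfield L)) L (IsCMField.complexConj L) →* ℂˣ) (ε : (↥(maximalRealSubfield L))ˣ)
    (v : HeightOneSpectrum (𝓞 ↥(maximalRealSubfield L)))
    (hsl : (toHeckeCharacter L μ).semilocalComponent L v = (toHeckeCharacter L μ').semilocalComponent L v)
    (hiso :
      isotypicComponent (MonoidAlgebra ℂ (localPi L (IsCMField.complexConj L) 3 H v))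
        (Representation.asModule (σ.comp (inclPlace (↥(maximalRealSubfield L)) L (IsCMField.complexConj L) 3 H v)))
        (Representation.asModule
          (((show Representation ℂ (localPi L (IsCMField.complexConj L) 3 (Matrix.diagonal dV) v) _ from
            (TwistedCoinv.rep (localCharOfCenter (↥(maximalRealSubfield L)) L (IsCMField.complexConj L)
                (JW (↥(maximalRealSubfield L)) L ε) (JW_apply_ne_zero (↥(maximalRealSubfield L)) L ε) χf v)
              ((OmegaChiSplitting.chiLocalSplittingsD ⟨L⟩ e₁ dV hdV hdV0 (toHeckeCharacter L μ')
                ((isOscillatorChar_toHeckeCharacter_iff μ').mpr hμ') ε).omegaLoc v)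
              (commute_omegaLoc_localCenter (↥(maximalRealSubfield L)) L (IsCMField.complexConj L) 3 e₁ (Matrix.diagonal dV)
                (JW (↥(maximalRealSubfield L)) L ε) (complexConj_imagUnit L) (imagUnit_ne_zero L) (imagUnit_mul_self L)
                (realDiagonal_isSymm L dV hdV) (isSymm_TW (↥(maximalRealSubfield L)) ε) (realDiagonal_map L dV hdV).symm
                (JW_eq (↥(maximalRealSubfield L)) L ε) (JW_apply_ne_zero (↥(maximalRealSubfield L)) L ε)
                (OmegaChiSplitting.chiLocalSplittingsD ⟨L⟩ e₁ dV hdV hdV0 (toHeckeCharacter L μ')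
                  ((isOscillatorChar_toHeckeCharacter_iff μ').mpr hμ') ε) v)).comp
              (UnitaryGroup.localLineInl L (IsCMField.complexConj L) 3 e₁ (Matrix.diagonal dV) (JW (↥(maximalRealSubfield L)) L ε) v)) :
              localPi L (IsCMField.complexConj L) 3 (Matrix.diagonal dV) v →* _).comp
            (localCongr L (IsCMField.complexConj L) g one_ne_zero
              (F0P2cOmegaLocalType.formCongr_frame L H dV g hg) v).symm.toMulEquiv.toMonoidHom)) = ⊤) :
    isotypicComponent (MonoidAlgebra ℂ (localPi L (IsCMField.complexConj L) 3 H v))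
      (Representation.asModule (σ.comp (inclPlace (↥(maximalRealSubfield L)) L (IsCMField.complexConj L) 3 H v)))
      (Representation.asModule
        (((show Representation ℂ (localPi L (IsCMField.complexConj L) 3 (Matrix.diagonal dV) v) _ from
          (TwistedCoinv.rep (localCharOfCenter (↥(maximalRealSubfield L)) L (IsCMField.complexConj L)
              (JW (↥(maximalRealSubfield L)) L ε) (JW_apply_ne_zero (↥(maximalRealSubfield L)) L ε) χf v)
            ((OmegaChiSplitting.chiLocalSplittingsD ⟨L⟩ e₁ dV hdV hdV0 (toHeckeCharacter L μ)
              ((isOscillatorChar_toHeckeCharacter_iff μ).mpr hμ) ε).omegaLoc v)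
            (commute_omegaLoc_localCenter (↥(maximalRealSubfield L)) L (IsCMField.complexConj L) 3 e₁ (Matrix.diagonal dV)
              (JW (↥(maximalRealSubfield L)) L ε) (complexConj_imagUnit L) (imagUnit_ne_zero L) (imagUnit_mul_self L)
              (realDiagonal_isSymm L dV hdV) (isSymm_TW (↥(maximalRealSubfield L)) ε) (realDiagonal_map L dV hdV).symm
              (JW_eq (↥(maximalRealSubfield L)) L ε) (JW_apply_ne_zero (↥(maximalRealSubfield L)) L ε)
              (OmegaChiSplitting.chiLocalSplittingsD ⟨L⟩ e₁ dV hdV hdV0 (toHeckeCharacter L μ)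
                ((isOscillatorChar_toHeckeCharacter_iff μ).mpr hμ) ε) v)).comp
            (UnitaryGroup.localLineInl L (IsCMField.complexConj L) 3 e₁ (Matrix.diagonal dV) (JW (↥(maximalRealSubfield L)) L ε) v)) :
            localPi L (IsCMField.complexConj L) 3 (Matrix.diagonal dV) v →* _).comp
          (localCongr L (IsCMField.complexConj L) g one_ne_zero
            (F0P2cOmegaLocalType.formCongr_frame L H dV g hg) v).symm.toMulEquiv.toMonoidHom)) = ⊤ :=
  (isotypicComponent_theta_congr L H e₁ dV hdV hdV0 g hg μ μ' hμ hμ' χf ε v hsl _).trans hiso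

set_option synthInstance.maxHeartbeats 400000 in
set_option maxHeartbeats 8000000 in
/-- **`ThetaTypeAt` is local in `μ`**: if `μ` and `μ'` have the same semi-local component at `v`, then «the class `c` is the theta type
`X_v(μ',ε,χf)∘κ_v⁻¹`» implies «`c` is the theta type `X_v(μ,ε,χf)∘κ_v⁻¹`» (LOCAL-TYPE currency).  Hypothesis and conclusion = the body of
`F0P2PKPiRung4.ThetaTypeAt` VERBATIM (v1.1 :247) at `(μ', hμ')` resp. `(μ, hμ)`; proof = §3 at `M := ρ'.asModule`.
[cite: GelbartRogawski1991, §5.1 (5.1.1), Lem 5.1.2 p. 466] [cite: Liu2021, App. D §D.1 Step 2] [cite: Kudla1994, §3 Thm. 3.1] -/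
theorem thetaTypeAt_congr_of_semilocal_eq (L : Type) [Field L] [NumberField L] [IsCMField L] (H : Matrix (Fin 3) (Fin 3) L) {n' : ℕ}
    (e₁ : Fin 3 × Fin 1 ≃ Fin n') (dV : Fin 3 → L) (hdV : ∀ i, IsCMField.complexConj L (dV i) = dV i) (hdV0 : ∀ i, dV i ≠ 0)
    (g : GL (Fin 3) L) (hg : ((g : Matrix (Fin 3) (Fin 3) L).map (cmConjRingHom L))ᵀ * H * (g : Matrix (Fin 3) (Fin 3) L) = Matrix.diagonal dV)
    (μ μ' : Literature.NumberTheory.Automorphic.IdeleClassGroup L →ₜ* Circle) (hμ : IsConjugateSymplectic L μ)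
    (hμ' : IsConjugateSymplectic L μ')
    (χf : UnitaryGroup.finAdelicOne (↥(maximalRealSubfield L)) L (IsCMField.complexConj L) →* ℂˣ) (ε : (↥(maximalRealSubfield L))ˣ)
    (v : HeightOneSpectrum (𝓞 ↥(maximalRealSubfield L))) (c : IrrClass ((cmDatum L 3 H).Local v))
    (hsl : (toHeckeCharacter L μ).semilocalComponent L v = (toHeckeCharacter L μ').semilocalComponent L v)
    (hΘ :
      ∀ (T : Type) [AddCommGroup T] [Module ℂ T] (τ : Representation ℂ ↥(localPi L (IsCMField.complexConj L) 3 H v) T), τ.IsIrreducible →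
        (IrrClass.comap (localPiEquiv L (IsCMField.complexConj L) 3 H v) c).IsConstituentOf τ →
        ∀ (W' : Type) [AddCommGroup W'] [Module ℂ W'] (ρ' : Representation ℂ ↥(localPi L (IsCMField.complexConj L) 3 H v) W'),
          isotypicComponent (MonoidAlgebra ℂ (localPi L (IsCMField.complexConj L) 3 H v)) (Representation.asModule ρ')
              (Representation.asModule τ) = ⊤ →
          isotypicComponent (MonoidAlgebra ℂ (localPi L (IsCMField.complexConj L) 3 H v)) (Representation.asModule ρ')
            (Representation.asModule
              (((show Representation ℂ (localPi L (IsCMField.complexConj L) 3 (Matrix.diagonal dV) v) _ from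
                (TwistedCoinv.rep (localCharOfCenter (↥(maximalRealSubfield L)) L (IsCMField.complexConj L)
                    (JW (↥(maximalRealSubfield L)) L ε) (JW_apply_ne_zero (↥(maximalRealSubfield L)) L ε) χf v)
                  ((OmegaChiSplitting.chiLocalSplittingsD ⟨L⟩ e₁ dV hdV hdV0 (toHeckeCharacter L μ')
                    ((isOscillatorChar_toHeckeCharacter_iff μ').mpr hμ') ε).omegaLoc v)
                  (commute_omegaLoc_localCenter (↥(maximalRealSubfield L)) L (IsCMField.complexConj L) 3 e₁ (Matrix.diagonal dV)
                    (JW (↥(maximalRealSubfield L)) L ε) (complexConj_imagUnit L) (imagUnit_ne_zero L) (imagUnit_mul_self L)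
                    (realDiagonal_isSymm L dV hdV) (isSymm_TW (↥(maximalRealSubfield L)) ε) (realDiagonal_map L dV hdV).symm
                    (JW_eq (↥(maximalRealSubfield L)) L ε) (JW_apply_ne_zero (↥(maximalRealSubfield L)) L ε)
                    (OmegaChiSplitting.chiLocalSplittingsD ⟨L⟩ e₁ dV hdV hdV0 (toHeckeCharacter L μ')
                      ((isOscillatorChar_toHeckeCharacter_iff μ').mpr hμ') ε) v)).comp
                  (UnitaryGroup.localLineInl L (IsCMField.complexConj L) 3 e₁ (Matrix.diagonal dV) (JW (↥(maximalRealSubfield L)) L ε) v)) :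
                  localPi L (IsCMField.complexConj L) 3 (Matrix.diagonal dV) v →* _).comp
                (localCongr L (IsCMField.complexConj L) g one_ne_zero
                  (F0P2cOmegaLocalType.formCongr_frame L H dV g hg) v).symm.toMulEquiv.toMonoidHom)) = ⊤) :
    ∀ (T : Type) [AddCommGroup T] [Module ℂ T] (τ : Representation ℂ ↥(localPi L (IsCMField.complexConj L) 3 H v) T), τ.IsIrreducible →
      (IrrClass.comap (localPiEquiv L (IsCMField.complexConj L) 3 H v) c).IsConstituentOf τ →
      ∀ (W' : Type) [AddCommGroup W'] [Module ℂ W'] (ρ' : Representation ℂ ↥(localPi L (IsCMField.complexConj L) 3 H v) W'),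
        isotypicComponent (MonoidAlgebra ℂ (localPi L (IsCMField.complexConj L) 3 H v)) (Representation.asModule ρ')
            (Representation.asModule τ) = ⊤ →
        isotypicComponent (MonoidAlgebra ℂ (localPi L (IsCMField.complexConj L) 3 H v)) (Representation.asModule ρ')
          (Representation.asModule
            (((show Representation ℂ (localPi L (IsCMField.complexConj L) 3 (Matrix.diagonal dV) v) _ from
              (TwistedCoinv.rep (localCharOfCenter (↥(maximalRealSubfield L)) L (IsCMField.complexConj L)
                  (JW (↥(maximalRealSubfield L)) L ε) (JW_apply_ne_zero (↥(maximalRealSubfield L)) L ε) χf v)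
                ((OmegaChiSplitting.chiLocalSplittingsD ⟨L⟩ e₁ dV hdV hdV0 (toHeckeCharacter L μ)
                  ((isOscillatorChar_toHeckeCharacter_iff μ).mpr hμ) ε).omegaLoc v)
                (commute_omegaLoc_localCenter (↥(maximalRealSubfield L)) L (IsCMField.complexConj L) 3 e₁ (Matrix.diagonal dV)
                  (JW (↥(maximalRealSubfield L)) L ε) (complexConj_imagUnit L) (imagUnit_ne_zero L) (imagUnit_mul_self L)
                  (realDiagonal_isSymm L dV hdV) (isSymm_TW (↥(maximalRealSubfield L)) ε) (realDiagonal_map L dV hdV).symm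
                  (JW_eq (↥(maximalRealSubfield L)) L ε) (JW_apply_ne_zero (↥(maximalRealSubfield L)) L ε)
                  (OmegaChiSplitting.chiLocalSplittingsD ⟨L⟩ e₁ dV hdV hdV0 (toHeckeCharacter L μ)
                    ((isOscillatorChar_toHeckeCharacter_iff μ).mpr hμ) ε) v)).comp
                (UnitaryGroup.localLineInl L (IsCMField.complexConj L) 3 e₁ (Matrix.diagonal dV) (JW (↥(maximalRealSubfield L)) L ε) v)) :
                localPi L (IsCMField.complexConj L) 3 (Matrix.diagonal dV) v →* _).comp
              (localCongr L (IsCMField.complexConj L) g one_ne_zero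
                (F0P2cOmegaLocalType.formCongr_frame L H dV g hg) v).symm.toMulEquiv.toMonoidHom)) = ⊤ := by
  intro T _ _ τ hτ hconst W' _ _ ρ' hρ'
  exact (isotypicComponent_theta_congr L H e₁ dV hdV hdV0 g hg μ μ' hμ hμ' χf ε v hsl (Representation.asModule ρ')).trans
    (hΘ T τ hτ hconst W' ρ' hρ')


end Summit.HodgeConjecture.HodgeConjecture.Cruxes.H413.F0P2iGRDLocality

end
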